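import Summits.RiemannHypothesis.RiemannHypothesis.Theorems.HandoffDodgerWitnessLink
import Summits.RiemannHypothesis.RiemannHypothesis.Theorems.HandoffDodgerEdgeCoefficient
import Summits.RiemannHypothesis.RiemannHypothesis.Theorems.HandoffDodgerNodePairing
import Summits.RiemannHypothesis.RiemannHypothesis.Theorems.HandoffDodgerCollarProfile
import HarnessLib

/-!
# HANDOFF — the EDGE VALUE of the dodger cut-off (rh-explicit, track «HANDOFF», seat prove-2 gen9, ATTEMPT-16 Lemma A2 / ATTEMPT-18 (R-3))

HONEST FRAMING. Nothing here bears on the truth of RH; this is the first brick of the RH-free GAIN side of ATTEMPT-16's THEOREM 16.2.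
The dodger cut-off `F₀ = cutoffCosPoly b K (dodgerCoeff b T K)` (`K = N(T)`, killed multiset `zerosBetween 0 T`, nodes `z_ρ = Im ρ + i(½ − Re ρ)`,
lattice `ℓ_k = πk/b`) takes at its edge the value

  `F₀(b) = (1/2b) · Π_{k<K} ℓ_{k+1}² / Π_ρ (z_ρ²)^{m(ρ)}`      (`cutoffCosPoly_dodger_edge`),  hence  `‖F₀(b)‖ = c_∞/(2b)`  (`norm_cutoffCosPoly_dodger_edge`)

with `c_∞ = Π_kℓ_{k+1}²/Π_ρ‖z_ρ‖^{2m}` — the SAME constant as in the cost theorem `HandoffDodgerCostTheorem.dodger_cost_le`. Ingredients: the edge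
evaluation of a cut-off cosine polynomial (`cos(ℓ_{k+1}b) = (−1)^{k+1}`), the coefficient formula `dodgerCoeff_spec`, the edge identity
`HandoffDodgerEdgeCoefficient.coeff_mul_prod_neg_eq_one_sub_sum`, and the top coefficient of `dodgerPoly` (`coeff_dodgerPoly`). SIGN: by the node pairing
`HandoffDodgerNodePairing.prod_dodgerNode_sq_pow_eq` (`Π_ρ(z_ρ²)^m = Π_ρ‖z_ρ‖^{2m}`, the `ρ ↦ 1−ρ̄` involution) the edge value IS the positive real
`c_∞/(2b)` (`cutoffCosPoly_dodger_edge_ofReal`, `re_cutoffCosPoly_dodger_edge_pos`) — the sign the collar lemmas of `HandoffDodgerCollar` need.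
No `sorry`, standard axioms, no definitions.

References: this track (ATTEMPT-16 §2 Lemma A2; ATTEMPT-18 §3 (R-3)).
-/

set_option linter.dupNamespace false

noncomputable section

open Complex Polynomial Finset
open scoped Real

namespace Summit.RiemannHypothesis.RiemannHypothesis.Theorems.Handoff

open Literature.NumberTheory.LFunctions Literature.NumberTheory.LFunctions.SchoenfeldBound

/-! ## The edge value of a cut-off cosine polynomial -/

/-- At the edge `x = b` (`b > 0`): `cos(ℓ_{k+1}b) = cos(π(k+1)) = (−1)^{k+1}`, so
`cutoffCosPoly b K a b = (1/2b)(1 + 2Σ_{k<K} a_{k+1}(−1)^{k+1})`. [this track, ATTEMPT-16 Lemma A2] -/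
theorem cutoffCosPoly_apply_edge {b : ℝ} (hb : 0 < b) (K : ℕ) (a : ℕ → ℝ) :
    cutoffCosPoly b K a b = (((1 / (2 * b)) * (1 + 2 * ∑ k ∈ Finset.range K, a (k + 1) * (-1) ^ (k + 1)) : ℝ) : ℂ) := by
  have hmem : b ∈ Set.Icc (-b) b := Set.mem_Icc.2 ⟨by linarith, le_rfl⟩
  have hcos : ∀ k : ℕ, Real.cos (latticeFreq b (k + 1) * b) = (-1) ^ (k + 1) := by
    intro k
    rw [show latticeFreq b (k + 1) * b = ((k + 1 : ℕ) : ℝ) * π by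
      unfold latticeFreq; rw [div_mul_cancel₀ _ hb.ne', mul_comm]]
    exact Real.cos_nat_mul_pi _
  rw [cutoffCosPoly, Set.indicator_of_mem hmem]
  simp_rw [hcos]

/-! ## The top coefficient of the dodger polynomial -/

/-- A factor `1 − cX` (`c ≠ 0`) has `natDegree = 1` and leading coefficient `−c`. [folklore] -/
theorem natDegree_one_sub_C_mul_X {c : ℂ} (hc : c ≠ 0) :
    (1 - C c * X : ℂ[X]).natDegree = 1 ∧ (1 - C c * X : ℂ[X]).leadingCoeff = -c := by
  have e : (1 - C c * X : ℂ[X]) = C (-c) * X + C 1 := by rw [C_neg, C_1]; ring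
  rw [e]
  exact ⟨natDegree_linear (neg_ne_zero.2 hc), leadingCoeff_linear (neg_ne_zero.2 hc)⟩

/-- `deg P_T = N(T)` exactly. [this track, ATTEMPT-18 (D-3)] -/
theorem natDegree_dodgerPoly (T : ℝ) : (dodgerPoly T).natDegree = zetaZeroCount T := by
  have hfac : ∀ ρ ∈ zerosBetween 0 T,
      (1 - C ((dodgerNode ρ ^ 2)⁻¹) * X : ℂ[X]).natDegree = 1 ∧ (1 - C ((dodgerNode ρ ^ 2)⁻¹) * X : ℂ[X]).leadingCoeff = -(dodgerNode ρ ^ 2)⁻¹ := by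
    intro ρ hρ
    have him : ρ.im ≠ 0 := (((mem_zerosBetween le_rfl).1 hρ).2.2.2.1).ne'
    exact natDegree_one_sub_C_mul_X (inv_ne_zero (pow_ne_zero 2 (dodgerNode_ne_zero him)))
  have hne : ∀ ρ ∈ zerosBetween 0 T, (1 - C ((dodgerNode ρ ^ 2)⁻¹) * X : ℂ[X]) ^ (riemannZetaZeroOrder ρ).toNat ≠ 0 := by
    intro ρ hρ
    refine pow_ne_zero _ (ne_zero_of_natDegree_gt (n := 0) ?_)
    rw [(hfac ρ hρ).1]
    exact zero_lt_one
  unfold dodgerPoly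
  rw [natDegree_prod _ _ hne, ← sum_zeroOrder_toNat_eq T]
  refine Finset.sum_congr rfl fun ρ hρ => ?_
  rw [natDegree_pow, (hfac ρ hρ).1, mul_one]

/-- **The top coefficient of the dodger polynomial**: `P_T.coeff N(T) = Π_ρ (−(z_ρ²)⁻¹)^{m(ρ)}`. [this track, ATTEMPT-18 (D-3)] -/
theorem coeff_dodgerPoly (T : ℝ) :
    (dodgerPoly T).coeff (zetaZeroCount T) =
      ∏ ρ ∈ zerosBetween 0 T, (-(dodgerNode ρ ^ 2)⁻¹) ^ (riemannZetaZeroOrder ρ).toNat := by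
  rw [← natDegree_dodgerPoly T, coeff_natDegree]
  unfold dodgerPoly
  rw [leadingCoeff_prod]
  refine Finset.prod_congr rfl fun ρ hρ => ?_
  have him : ρ.im ≠ 0 := (((mem_zerosBetween le_rfl).1 hρ).2.2.2.1).ne'
  rw [leadingCoeff_pow, (natDegree_one_sub_C_mul_X (inv_ne_zero (pow_ne_zero 2 (dodgerNode_ne_zero him)))).2]

/-! ## The edge value of the dodger -/

/-- The dodger coefficients termwise: `2a_{k+1}(−1)^{k+1} = −w_k`, `w_k := P_T(ν_k)/Π_{m≠k}(1 − ν_k/ν_m)` (`ν_k = ℓ_{k+1}²`).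
[this track, ATTEMPT-16 Lemma A2] -/
theorem two_mul_dodgerCoeff_mul_sign (b T : ℝ) (K : ℕ) (k : Fin K) :
    (2 : ℂ) * ((dodgerCoeff b T K (k.val + 1) : ℝ) : ℂ) * (-1) ^ (k.val + 1) =
      -((dodgerPoly T).eval (((latticeFreq b (k.val + 1)) ^ 2 : ℝ) : ℂ) /
        ∏ m ∈ univ.erase k, (1 - (((latticeFreq b (k.val + 1)) ^ 2 : ℝ) : ℂ) / (((latticeFreq b (m.val + 1)) ^ 2 : ℝ) : ℂ))) := by
  rw [dodgerCoeff_spec, dodgerCoeffC, pow_succ]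
  set u : ℂ := (-1) ^ (k.val : ℕ) with hu
  set ev : ℂ := (dodgerPoly T).eval (((latticeFreq b (k.val + 1)) ^ 2 : ℝ) : ℂ)
  set Pm : ℂ := ∏ m ∈ univ.erase k, (1 - (((latticeFreq b (k.val + 1)) ^ 2 : ℝ) : ℂ) / (((latticeFreq b (m.val + 1)) ^ 2 : ℝ) : ℂ))
  have h1 : u * u = 1 := by rw [hu, ← mul_pow, neg_mul_neg, one_mul, one_pow]
  calc (2 : ℂ) * (u * ev / (2 * Pm)) * (u * -1) = -((u * u) * (2 * ev / (2 * Pm))) := by ring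
    _ = -(ev / Pm) := by rw [h1, one_mul, mul_div_mul_left _ _ two_ne_zero]

/-- The weights `w_k` are real. [this track, ATTEMPT-18 (D-3)] -/
theorem im_dodgerWeight_eq_zero (b T : ℝ) (K : ℕ) (k : Fin K) :
    ((dodgerPoly T).eval (((latticeFreq b (k.val + 1)) ^ 2 : ℝ) : ℂ) /
        ∏ m ∈ univ.erase k, (1 - (((latticeFreq b (k.val + 1)) ^ 2 : ℝ) : ℂ) / (((latticeFreq b (m.val + 1)) ^ 2 : ℝ) : ℂ))).im = 0 := by
  have h := congrArg Complex.im (two_mul_dodgerCoeff_mul_sign b T K k)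
  rw [Complex.neg_im] at h
  have h2 : ((2 : ℂ) * ((dodgerCoeff b T K (k.val + 1) : ℝ) : ℂ) * (-1) ^ (k.val + 1)).im = 0 := by
    rw [show (2 : ℂ) * ((dodgerCoeff b T K (k.val + 1) : ℝ) : ℂ) * (-1) ^ (k.val + 1) =
      ((2 * dodgerCoeff b T K (k.val + 1) * (-1) ^ (k.val + 1) : ℝ) : ℂ) by push_cast; ring, Complex.ofReal_im]
  linarith

/-- The coefficient sum of the dodger at the edge: `2Σ_{k<K} a_{k+1}(−1)^{k+1} = −Σ_k w_k`. [this track, ATTEMPT-16 Lemma A2] -/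
theorem two_mul_sum_dodgerCoeff_alt (b T : ℝ) (K : ℕ) :
    (2 : ℂ) * ∑ k ∈ Finset.range K, ((dodgerCoeff b T K (k + 1) : ℝ) : ℂ) * (-1) ^ (k + 1) =
      -∑ k : Fin K, (dodgerPoly T).eval (((latticeFreq b (k.val + 1)) ^ 2 : ℝ) : ℂ) /
        ∏ m ∈ univ.erase k, (1 - (((latticeFreq b (k.val + 1)) ^ 2 : ℝ) : ℂ) / (((latticeFreq b (m.val + 1)) ^ 2 : ℝ) : ℂ)) := by
  rw [← Fin.sum_univ_eq_sum_range (fun k => ((dodgerCoeff b T K (k + 1) : ℝ) : ℂ) * (-1) ^ (k + 1)) K, Finset.mul_sum,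
    ← Finset.sum_neg_distrib]
  refine Finset.sum_congr rfl fun k _ => ?_
  rw [← two_mul_dodgerCoeff_mul_sign b T K k, mul_assoc]

/-- **The edge value of the dodger (ATTEMPT-16 Lemma A2)**: for `b > 0`, any `T`, `K = N(T)`,
`F₀(b) = (1/2b) · Π_{k<K} ℓ_{k+1}² / Π_ρ (z_ρ²)^{m(ρ)}`. [this track, ATTEMPT-16 Lemma A2; ATTEMPT-18 (R-3)] -/
theorem cutoffCosPoly_dodger_edge {b : ℝ} (hb : 0 < b) (T : ℝ) :
    cutoffCosPoly b (zetaZeroCount T) (dodgerCoeff b T (zetaZeroCount T)) b =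
      (1 / (2 * b) : ℂ) *
        ((∏ k ∈ Finset.range (zetaZeroCount T), ((latticeFreq b (k + 1) : ℂ)) ^ 2) /
          ∏ ρ ∈ zerosBetween 0 T, (dodgerNode ρ ^ 2) ^ (riemannZetaZeroOrder ρ).toNat) := by
  set K : ℕ := zetaZeroCount T with hK
  rw [cutoffCosPoly_apply_edge hb]
  push_cast
  congr 1
  -- the nodes
  set ν : Fin K → ℂ := fun k => (((latticeFreq b (k.val + 1)) ^ 2 : ℝ) : ℂ) with hν
  have hν0 : ∀ k, ν k ≠ 0 := fun k => latticeFreq_sq_ne_zero hb.ne' K k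
  have hνinj : Function.Injective ν := latticeFreq_sq_injective hb K
  have hsum := two_mul_sum_dodgerCoeff_alt b T K
  have hid := coeff_mul_prod_neg_eq_one_sub_sum ν hνinj hν0 (dodgerPoly T) (dodgerPoly_eval_zero T)
    (hK ▸ natDegree_dodgerPoly_le T)
  simp only [hν] at hid
  rw [hsum, ← sub_eq_add_neg, ← hid, hK, coeff_dodgerPoly T, ← hK]
  -- signs and inverses
  rw [Finset.prod_neg, card_univ, Fintype.card_fin,
    Fin.prod_univ_eq_prod_range (fun k => (((latticeFreq b (k + 1)) ^ 2 : ℝ) : ℂ)) K]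
  have hm : ∏ ρ ∈ zerosBetween 0 T, (-(dodgerNode ρ ^ 2)⁻¹) ^ (riemannZetaZeroOrder ρ).toNat =
      (-1) ^ K * (∏ ρ ∈ zerosBetween 0 T, (dodgerNode ρ ^ 2) ^ (riemannZetaZeroOrder ρ).toNat)⁻¹ := by
    rw [← Finset.prod_inv_distrib, hK, ← sum_zeroOrder_toNat_eq T, ← Finset.prod_pow_eq_pow_sum, ← Finset.prod_mul_distrib]
    refine Finset.prod_congr rfl fun ρ _ => ?_
    rw [neg_pow, inv_pow]
  rw [hm]
  have hKK : ((-1 : ℂ) ^ K) * (-1) ^ K = 1 := by rw [← mul_pow, neg_mul_neg, one_mul, one_pow]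
  push_cast
  calc (-1 : ℂ) ^ K * (∏ ρ ∈ zerosBetween 0 T, (dodgerNode ρ ^ 2) ^ (riemannZetaZeroOrder ρ).toNat)⁻¹ *
        ((-1) ^ K * ∏ k ∈ Finset.range K, ((latticeFreq b (k + 1) : ℂ)) ^ 2)
      = ((-1 : ℂ) ^ K * (-1) ^ K) * ((∏ k ∈ Finset.range K, ((latticeFreq b (k + 1) : ℂ)) ^ 2) *
          (∏ ρ ∈ zerosBetween 0 T, (dodgerNode ρ ^ 2) ^ (riemannZetaZeroOrder ρ).toNat)⁻¹) := by ring
    _ = _ := by rw [hKK, one_mul, div_eq_mul_inv]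

/-- **The modulus of the edge value**: `‖F₀(b)‖ = c_∞/(2b)` with `c_∞ = Π_kℓ_{k+1}²/Π_ρ‖z_ρ‖^{2m}` — the constant of the cost theorem.
[this track, ATTEMPT-16 Lemma A2; ATTEMPT-18 (R-3)] -/
theorem norm_cutoffCosPoly_dodger_edge {b : ℝ} (hb : 0 < b) (T : ℝ) :
    ‖cutoffCosPoly b (zetaZeroCount T) (dodgerCoeff b T (zetaZeroCount T)) b‖ =
      1 / (2 * b) *
        ((∏ k ∈ Finset.range (zetaZeroCount T), (latticeFreq b (k + 1)) ^ 2) /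
          ∏ ρ ∈ zerosBetween 0 T, ‖dodgerNode ρ‖ ^ (2 * (riemannZetaZeroOrder ρ).toNat)) := by
  have h1 : ‖(1 / (2 * b) : ℂ)‖ = 1 / (2 * b) := by
    rw [show (1 / (2 * b) : ℂ) = ((1 / (2 * b) : ℝ) : ℂ) by push_cast; ring, Complex.norm_real, Real.norm_eq_abs,
      abs_of_pos (by positivity)]
  rw [cutoffCosPoly_dodger_edge hb T, norm_mul, h1, norm_div, norm_prod, norm_prod]
  congr 2
  · exact Finset.prod_congr rfl fun k _ => by rw [norm_pow, Complex.norm_real, Real.norm_eq_abs, sq_abs]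
  · exact Finset.prod_congr rfl fun ρ _ => by rw [norm_pow, norm_pow, ← pow_mul]

/-- **The edge value is the positive real `c_∞/(2b)`** (node pairing). [this track, ATTEMPT-16 Lemma A2; ATTEMPT-18 (R-3)] -/
theorem cutoffCosPoly_dodger_edge_ofReal {b : ℝ} (hb : 0 < b) (T : ℝ) :
    cutoffCosPoly b (zetaZeroCount T) (dodgerCoeff b T (zetaZeroCount T)) b =
      (((1 / (2 * b)) *
          ((∏ k ∈ Finset.range (zetaZeroCount T), (latticeFreq b (k + 1)) ^ 2) /
            ∏ ρ ∈ zerosBetween 0 T, ‖dodgerNode ρ‖ ^ (2 * (riemannZetaZeroOrder ρ).toNat)) : ℝ) : ℂ) := by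
  rw [cutoffCosPoly_dodger_edge hb T, prod_dodgerNode_sq_pow_eq T]
  push_cast
  rfl

/-- `F₀(b) > 0`. [this track, ATTEMPT-18 (R-3)] -/
theorem re_cutoffCosPoly_dodger_edge_pos {b : ℝ} (hb : 0 < b) (T : ℝ) :
    0 < (cutoffCosPoly b (zetaZeroCount T) (dodgerCoeff b T (zetaZeroCount T)) b).re := by
  rw [cutoffCosPoly_dodger_edge_ofReal hb T, Complex.ofReal_re]
  have h1 : 0 < ∏ k ∈ Finset.range (zetaZeroCount T), (latticeFreq b (k + 1)) ^ 2 :=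
    Finset.prod_pos fun k _ => by unfold latticeFreq; positivity
  exact mul_pos (by positivity) (div_pos h1 (prod_norm_dodgerNode_pow_pos T))

/-- **The dodger on the collar (D1 entry point)**: for `0 ≤ σ ≤ 2b`,
`Re F₀(b − σ) = c_∞/(2b) + (1/b)·Σ_k Re(w_k)·sin²(ℓ_{k+1}σ/2)`, `w_k = P_T(ℓ_{k+1}²)/Π_{m≠k}(1 − ℓ_{k+1}²/ℓ_{m+1}²)` (real).
[this track, ATTEMPT-16 §3 Lemma D1; ATTEMPT-18 (R-3)] -/
theorem re_cutoffCosPoly_dodger_edge_sub {b : ℝ} (hb : 0 < b) (T : ℝ) {σ : ℝ} (h0 : 0 ≤ σ) (h2 : σ ≤ 2 * b) :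
    (cutoffCosPoly b (zetaZeroCount T) (dodgerCoeff b T (zetaZeroCount T)) (b - σ)).re =
      1 / (2 * b) *
          ((∏ k ∈ Finset.range (zetaZeroCount T), (latticeFreq b (k + 1)) ^ 2) /
            ∏ ρ ∈ zerosBetween 0 T, ‖dodgerNode ρ‖ ^ (2 * (riemannZetaZeroOrder ρ).toNat)) +
        1 / b * ∑ k : Fin (zetaZeroCount T),
          ((dodgerPoly T).eval (((latticeFreq b (k.val + 1)) ^ 2 : ℝ) : ℂ) /
              ∏ m ∈ univ.erase k, (1 - (((latticeFreq b (k.val + 1)) ^ 2 : ℝ) : ℂ) /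
                (((latticeFreq b (m.val + 1)) ^ 2 : ℝ) : ℂ))).re *
            Real.sin (latticeFreq b (k.val + 1) * σ / 2) ^ 2 := by
  set K : ℕ := zetaZeroCount T with hK
  rw [re_cutoffCosPoly_edge_sub hb K _ h0 h2, cutoffCosPoly_dodger_edge_ofReal hb T, Complex.ofReal_re, ← hK]
  -- termwise: `a_{k+1}(−1)^{k+1} = −Re(w_k)/2`
  have hterm : ∀ k : Fin K, dodgerCoeff b T K (k.val + 1) * (-1) ^ (k.val + 1) =
      -((dodgerPoly T).eval (((latticeFreq b (k.val + 1)) ^ 2 : ℝ) : ℂ) /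
          ∏ m ∈ univ.erase k, (1 - (((latticeFreq b (k.val + 1)) ^ 2 : ℝ) : ℂ) /
            (((latticeFreq b (m.val + 1)) ^ 2 : ℝ) : ℂ))).re / 2 := by
    intro k
    have h := congrArg Complex.re (two_mul_dodgerCoeff_mul_sign b T K k)
    rw [show (2 : ℂ) * ((dodgerCoeff b T K (k.val + 1) : ℝ) : ℂ) * (-1) ^ (k.val + 1) =
      ((2 * (dodgerCoeff b T K (k.val + 1) * (-1) ^ (k.val + 1)) : ℝ) : ℂ) by push_cast; ring, Complex.ofReal_re,
      Complex.neg_re] at h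
    linarith
  rw [← Fin.sum_univ_eq_sum_range (fun k => dodgerCoeff b T K (k + 1) * (-1) ^ (k + 1) *
    Real.sin (latticeFreq b (k + 1) * σ / 2) ^ 2) K]
  simp only [hterm]
  rw [sub_eq_add_neg, ← mul_neg, ← Finset.sum_neg_distrib, Finset.mul_sum, Finset.mul_sum]
  congr 1
  refine Finset.sum_congr rfl fun k _ => ?_
  field_simp

end Summit.RiemannHypothesis.RiemannHypothesis.Theorems.Handoff

end
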